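import Mathlib
import Literature.Analysis.FluidPDE.VorticityCalculus
import Literature.Analysis.FluidPDE.VorticityStretching
import Literature.Analysis.FluidPDE.LocalBiotSavartCalculus
import Literature.Analysis.FluidPDE.TaoAveragedNondegeneracy
import Literature.Analysis.FluidPDE.NewtonKernel
import Summits.NavierStokesRegularity.NavierStokesRegularity.Theorems.ThreadingFluxCentreJetVorticityJet
import HarnessLib

/-!
# Crux `PoloidalLiouville` (stmt-NavierStokesRegularity-1222, wall W1), crux idea «steady-centre-sieve» (ns-idea-15 g5,
# `Cruxes/PoloidalLiouville/CentreJetSketch.lean`): the degree-1 CENTRE DRIFT LAW (E2), body VERBATIM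

Support file (Theorems-side; seat ns-wall-eng-7 g4, cell ns-wall-extremal, W1 adjunct; `--supports
stmt-NavierStokesRegularity-1222 --as helper`).  (E2, S) of the steady centre-jet sieve: for a classical steady Navier–Stokes flow on
`ℝ³` unthreaded about `x₀`, `V(x₀) × ΔV(x₀) = 0` — the velocity at the centre is parallel to `curl ω = −ΔV` there.

Proof: take the curl of the momentum equation `(V·∇)V + ∇p = ΔV` at `x₀` (`∇p = ΔV − (V·∇)V ∈ C¹`, so `p ∈ C²` and `curl ∇p = 0`;
`curl ΔV = Δω`; `curl (V·∇)V = (V·∇)ω − (ω·∇)V + (div V) ω`): with `ω(x₀) = 0`, `Δω(x₀) = 0` (E1, `CentreJet.centreVorticityJet`)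
this leaves `∇ω(x₀)[V(x₀)] = 0`; `∇ω(x₀)` is skew (E1), hence `∇ω(x₀) y = ½ (curl ω)(x₀) × y`, and `curl ω = curl curl V = −ΔV`
(`div V = 0`), so `ΔV(x₀) × V(x₀) = 0`.

* `CentreJet.centreDriftLaw` — body of the sketch's `CentreDriftLaw` verbatim (`IsSteadyNSOn univ V p`, `IsUnthreadedAbout x₀ V` unfolded).

HONEST LABEL: an elementary consequence of the steady vorticity equation at one point, about typed objects of one crux idea; the card's
conjectures and target, `PoloidalLiouville` (1222) and NS regularity remain OPEN and untouched; information-grade (movement 0).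
[cite: MajdaBertozziCUP2002, §1.1 (vector identities)] [cite: MajdaBertozziCUP2002, Prop. 2.16 (proof)]
-/

-- the summit and its single problem share the name (D-0017 nested layout)
set_option linter.dupNamespace false

noncomputable section

open Set Function
open scoped RealInnerProductSpace
open Literature.Analysis.FluidPDE

namespace Summit.NavierStokesRegularity.NavierStokesRegularity.Theorems.PoloidalLiouville.CentreJet

/-- **A skew endomorphism of `ℝ³` is a cross product**: if `⟪y, A y⟫ = 0` for all `y` then `A y = ½ (curlCLM A) × y`
(`curlCLM A = (a₁₂ − a₂₁, a₂₀ − a₀₂, a₀₁ − a₁₀)`, `aⱼᵢ = (A eⱼ)ᵢ`). -/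
theorem apply_eq_half_cross_curlCLM_of_skew (A : EuclideanSpace ℝ (Fin 3) →L[ℝ] EuclideanSpace ℝ (Fin 3))
    (hA : ∀ y : EuclideanSpace ℝ (Fin 3), ⟪y, A y⟫ = 0) (y : EuclideanSpace ℝ (Fin 3)) :
    A y = (1 / 2 : ℝ) • cross (curlCLM A) y := by
  -- coordinates of `curlCLM A`
  have hc0 : curlCLM A 0 = A (EuclideanSpace.single (1 : Fin 3) (1 : ℝ)) 2 - A (EuclideanSpace.single (2 : Fin 3) (1 : ℝ)) 1 := by simp [curlCLM, curlLM]
  have hc1 : curlCLM A 1 = A (EuclideanSpace.single (2 : Fin 3) (1 : ℝ)) 0 - A (EuclideanSpace.single (0 : Fin 3) (1 : ℝ)) 2 := by simp [curlCLM, curlLM]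
  have hc2 : curlCLM A 2 = A (EuclideanSpace.single (0 : Fin 3) (1 : ℝ)) 1 - A (EuclideanSpace.single (1 : Fin 3) (1 : ℝ)) 0 := by simp [curlCLM, curlLM]
  -- the law at `eᵢ` and `eᵢ + eⱼ`
  have q0 := hA (EuclideanSpace.single (0 : Fin 3) (1 : ℝ))
  have q1 := hA (EuclideanSpace.single (1 : Fin 3) (1 : ℝ))
  have q2 := hA (EuclideanSpace.single (2 : Fin 3) (1 : ℝ))
  have q01 := hA (EuclideanSpace.single (0 : Fin 3) (1 : ℝ) + EuclideanSpace.single (1 : Fin 3) (1 : ℝ))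
  have q02 := hA (EuclideanSpace.single (0 : Fin 3) (1 : ℝ) + EuclideanSpace.single (2 : Fin 3) (1 : ℝ))
  have q12 := hA (EuclideanSpace.single (1 : Fin 3) (1 : ℝ) + EuclideanSpace.single (2 : Fin 3) (1 : ℝ))
  simp [map_add, Tao2016.real_inner_fin3] at q0 q1 q2 q01 q02 q12
  -- expand `A y`
  have hy : y = y 0 • EuclideanSpace.single (0 : Fin 3) (1 : ℝ) + y 1 • EuclideanSpace.single (1 : Fin 3) (1 : ℝ) + y 2 • EuclideanSpace.single (2 : Fin 3) (1 : ℝ) := by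
    ext i
    fin_cases i <;> simp
  have hAy : A y = y 0 • A (EuclideanSpace.single (0 : Fin 3) (1 : ℝ)) + y 1 • A (EuclideanSpace.single (1 : Fin 3) (1 : ℝ)) + y 2 • A (EuclideanSpace.single (2 : Fin 3) (1 : ℝ)) := by
    conv_lhs => rw [hy]
    simp only [map_add, map_smul]
  rw [hAy]
  generalize hv0 : A (EuclideanSpace.single (0 : Fin 3) (1 : ℝ)) = v0 at q0 q1 q2 q01 q02 q12 hc0 hc1 hc2 ⊢
  generalize hv1 : A (EuclideanSpace.single (1 : Fin 3) (1 : ℝ)) = v1 at q0 q1 q2 q01 q02 q12 hc0 hc1 hc2 ⊢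
  generalize hv2 : A (EuclideanSpace.single (2 : Fin 3) (1 : ℝ)) = v2 at q0 q1 q2 q01 q02 q12 hc0 hc1 hc2 ⊢
  ext k
  fin_cases k
  · simp only [Fin.zero_eta, Fin.isValue, PiLp.add_apply, PiLp.smul_apply, smul_eq_mul, Tao2016.cross_apply_zero, hc1, hc2]
    linear_combination (y 0 - (1/2) * y 1 - (1/2) * y 2) * q0 - (1/2) * y 1 * q1 - (1/2) * y 2 * q2
      + (1/2) * y 1 * q01 + (1/2) * y 2 * q02
  · simp only [Fin.mk_one, Fin.isValue, PiLp.add_apply, PiLp.smul_apply, smul_eq_mul, Tao2016.cross_apply_one, hc0, hc2]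
    linear_combination (-(1/2) * y 0) * q0 + (y 1 - (1/2) * y 0 - (1/2) * y 2) * q1 - (1/2) * y 2 * q2
      + (1/2) * y 0 * q01 + (1/2) * y 2 * q12
  · simp only [Fin.reduceFinMk, Fin.isValue, PiLp.add_apply, PiLp.smul_apply, smul_eq_mul, Tao2016.cross_apply_two, hc0, hc1]
    linear_combination (-(1/2) * y 0) * q0 - (1/2) * y 1 * q1 + (y 2 - (1/2) * y 0 - (1/2) * y 1) * q2
      + (1/2) * y 0 * q02 + (1/2) * y 1 * q12

/-- `a × b = −(b × a)` for the tree's cross product (coordinates). -/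
private theorem cross_swap (a b : EuclideanSpace ℝ (Fin 3)) : cross a b = -cross b a := by
  ext i
  fin_cases i <;> (simp [cross, cross_apply]; try ring)

/-- ★ **(E2) `CentreDriftLaw`, body verbatim** (`IsSteadyNSOn univ V p` and `IsUnthreadedAbout x₀ V` unfolded): for a classical steady
Navier–Stokes flow on `ℝ³` unthreaded about `x₀`, `V(x₀) × ΔV(x₀) = 0`. -/
theorem centreDriftLaw :
    ∀ (V : EuclideanSpace ℝ (Fin 3) → EuclideanSpace ℝ (Fin 3)) (p : EuclideanSpace ℝ (Fin 3) → ℝ) (x₀ : EuclideanSpace ℝ (Fin 3)),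
      (ContDiffOn ℝ 3 V univ ∧ ContDiffOn ℝ 1 p univ ∧
          (∀ x ∈ (univ : Set (EuclideanSpace ℝ (Fin 3))), VectorCalculus.divergence V x = 0) ∧
          ∀ x ∈ (univ : Set (EuclideanSpace ℝ (Fin 3))),
            fderiv ℝ V x (V x) + gradient p x = Laplacian.laplacian V x) →
      (∀ x, inner ℝ (x - x₀) (curl V x) = 0) →
      cross (V x₀) (Laplacian.laplacian V x₀) = 0 := by
  rintro V p x₀ ⟨hV, hp, hdiv, hNS⟩ hun
  have hV3 : ContDiff ℝ 3 V := contDiffOn_univ.1 hV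
  have hV2 : ContDiff ℝ 2 V := hV3.of_le (by norm_num)
  have hdf : VectorCalculus.IsDivFree V := fun x => hdiv x (mem_univ x)
  obtain ⟨hω0, hskew, hΔω⟩ := centreVorticityJet V x₀ hV3 hun
  -- smoothness of the two sides of the momentum equation
  have hΔV1 : ContDiff ℝ 1 (Laplacian.laplacian V) := contDiff_laplacian (n := 1) (by exact_mod_cast hV3)
  have hDV2 : ContDiff ℝ 2 (fderiv ℝ V) := hV3.fderiv_right (m := 2) (by norm_num)
  have hconv1 : ContDiff ℝ 1 (fun x => fderiv ℝ V x (V x)) :=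
    (hDV2.of_le (by norm_num)).clm_apply (hV3.of_le (by norm_num))
  -- `∇p = ΔV − (V·∇)V`, hence `p ∈ C²` and `curl ∇p = 0`
  have hgrad : gradient p = fun x => Laplacian.laplacian V x - fderiv ℝ V x (V x) := by
    funext x
    have h := hNS x (mem_univ x)
    rw [← h]
    abel
  have hgp1 : ContDiff ℝ 1 (gradient p) := by
    rw [hgrad]
    exact hΔV1.sub hconv1
  have hp2 : ContDiff ℝ 2 p := by
    rw [show (2 : WithTop ℕ∞) = 1 + 1 by norm_num, contDiff_succ_iff_fderiv]
    refine ⟨(contDiffOn_univ.1 hp).differentiable one_ne_zero, fun h => absurd h (by simp), ?_⟩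
    have hfd : fderiv ℝ p = fun x => (InnerProductSpace.toDual ℝ (EuclideanSpace ℝ (Fin 3))) (gradient p x) := by
      funext x
      simp [gradient]
    rw [hfd]
    exact (InnerProductSpace.toDual ℝ (EuclideanSpace ℝ (Fin 3))).contDiff.comp hgp1
  have hcurl0 : curl (gradient p) x₀ = 0 := curl_gradient_eq_zero_holds p hp2 x₀
  -- curl of the right-hand side at `x₀`
  have hcurlΔ : curl (Laplacian.laplacian V) x₀ = 0 := by
    rw [curl_laplacian hV3 x₀]
    exact hΔω
  have hcurlconv : curl (fun x => fderiv ℝ V x (V x)) x₀ = fderiv ℝ (curl V) x₀ (V x₀) := by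
    have h := curl_convect_self hV2 x₀
    simp only [convect_apply, hω0, map_zero, smul_zero, sub_zero, add_zero] at h
    exact h
  -- so `∇ω(x₀) V(x₀) = 0`
  have hAv : fderiv ℝ (curl V) x₀ (V x₀) = 0 := by
    have h := hcurl0
    rw [hgrad, curl_sub ((hΔV1.differentiable one_ne_zero) x₀) ((hconv1.differentiable one_ne_zero) x₀),
      hcurlΔ, hcurlconv, zero_sub, neg_eq_zero] at h
    exact h
  -- `∇ω(x₀)` is skew: `∇ω(x₀) y = ½ (curl ω)(x₀) × y`, and `curl ω = −ΔV`
  have hrepr := apply_eq_half_cross_curlCLM_of_skew (fderiv ℝ (curl V) x₀) hskew (V x₀)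
  rw [hAv, ← curl_eq_curlCLM, curl_curl_eq_neg_laplacian hV2 hdf x₀] at hrepr
  -- `0 = ½ (−ΔV x₀) × V x₀`
  have h2 : cross (-(Laplacian.laplacian V) x₀) (V x₀) = 0 := by
    have h := hrepr.symm
    rwa [smul_eq_zero, or_iff_right (by norm_num : ¬ (1 / 2 : ℝ) = 0)] at h
  rw [cross_swap, neg_eq_zero]
  have h3 : cross (-(Laplacian.laplacian V) x₀) (V x₀) = -cross (Laplacian.laplacian V x₀) (V x₀) := by
    ext i
    fin_cases i <;> (simp [cross, cross_apply]; try ring)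
  rw [h3, neg_eq_zero] at h2
  exact h2

end Summit.NavierStokesRegularity.NavierStokesRegularity.Theorems.PoloidalLiouville.CentreJet

end
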